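/-
Copyright (c) 2026 the pub-hodgecm-mathlib formalisation cell (harness21).  Prover seat hodgecm-mathlib-K2E4-p07 (g4), Track B «K2-LIT» ∕ h413
(stmt-HodgeConjecture-24833, supports-only): the E4-consumed CLOSER of the E3-owned junction socket ‹S› `sig_K2E3SingularTransferSigned` (FGC :380) on ROAD J —
K2E4-plan (g2) CLOSER PLAN 02:21:28Z + AMENDMENT 02:32:22Z, chair K2-lead (g0) «=» 02:39:37Z, road owner K2E3-p15 (g3) 02:34:54Z (o3), typist hand-over K2E4-p14 (g3) 02:42:20Z,
K2E4-r02 (g2) type pre-dock 02:33:01Z.  2026-09-04.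
-/
import Literature.NumberTheory.Rogawski1990.TamagawaSingularMembersFinTFCovol   -- ★ p844690: the letters' FRAME (`CanonicalTransferMatrix`, `ArchCanonicalSingularMatrix`, `IsLocalTransferDatum`, `localStableOrbitalIntegral`, …)
import Literature.NumberTheory.Weil1982.UnitaryFinCentralizerTopFormHaar         -- ★ p850468 `UnitaryFinTopForm.finTamagawaPartner` (|ω|_v-Tamagawa partners)
import Literature.NumberTheory.Rogawski1990.FinExplicitTransferFactorConjLeft     -- ★ `finExplicitDelta_conj_left_all`
import Literature.NumberTheory.Rogawski1990.FinExplicitTransferFactorConjRight    -- ★ `finExplicitDelta_conj_right_all`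
import Literature.NumberTheory.Rogawski1990.ArchCanonicalTransferFactor           -- ★ `archCanonicalTransferFactor`
import Literature.NumberTheory.Rogawski1990.ExplicitFactorProductFormula          -- ★ `finExplicitCollection`, `UnitaryGroup.PlacesOver`
import Literature.NumberTheory.Automorphic.QuadraticHeckeCharacterCM              -- ★ `quadraticHeckeCharCM`
import Summits.HodgeConjecture.HodgeConjecture.Theorems.K2E3SingularTransferSignedOfLocal                       -- ★ p855489 (K2E4-p06): ‹S_loc› → ‹S› under the frame (`singularTransferSigned_of_local`)
import Summits.HodgeConjecture.HodgeConjecture.Theorems.K2E3SingularTransferSignedLocalOfLocalGermValue          -- ★ p856015 (K2E4-p06): ‹J♮› → ‹B_loc› → ‹S_loc›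
import Summits.HodgeConjecture.HodgeConjecture.Theorems.K2E3SingularTransferLocalGermValueOfRoadJ               -- ★ p856362 (K2E4-p09): (β) ‹J3 v2› → ‹J♮› (brings the ‹J3› v2 vocabulary)
import Summits.HodgeConjecture.HodgeConjecture.Theorems.K2E3CentralTransferVanishingLocalOfEllipticGerms         -- ★ p855613 (K2E4-p06): ‹(ii′)› → ‹B_loc^{ns}›, ‹B_loc^{ns}› + ‹B_loc^{split}› → ‹B_loc›
import Summits.HodgeConjecture.HodgeConjecture.Theorems.K2E3SingularLimitFormulaHSideEllipticOfCore             -- ★ p855627 (K2E4-p06): ‹(ii♭′)› → ‹(ii′)›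
import Summits.HodgeConjecture.HodgeConjecture.Theorems.K2E3CentralGermExpansionHOfEPWitness                    -- ★ p855822 (K2E4-p06): CERT♮ ‹(E)› → ‹(H♮)› → ‹(S′♮)› → ‹(ii♭′)›
import Summits.HodgeConjecture.HodgeConjecture.Theorems.K2E3CentralGermEPWitnessStable                           -- ★ p855868 (K2E4-p21): ‹(S′♮)› outright
import Summits.HodgeConjecture.HodgeConjecture.Theorems.K2E3CentralGermIndependenceNstOfHomogeneityRay            -- ★ p855908 (K2E4-p18): ‹(HOM-ray♮)› → ‹(H♮)›
import Summits.HodgeConjecture.HodgeConjecture.Theorems.K2E3CentralGermHomogeneityRayNstOfReference             -- ★ p855909 (K2E4-p18): ‹DUAL_z› → ‹HOM-ray*♮› → ‹HOM-ray♮›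
import Summits.HodgeConjecture.HodgeConjecture.Theorems.K2E3CentralGermHomogeneityRayNstRefOfUnipotentScaling   -- ★ p855910 (K2E4-p18): ‹(E)› → ‹DUAL_z› → ‹Ψ-package♮› → ‹HOM-ray*♮›
import Summits.HodgeConjecture.HodgeConjecture.Theorems.K2E3CentralGermExpansionExistenceOfRao                  -- ★ p855998 (K2E3-p23): ‹RAO_z› → ‹DUAL_z› → ‹(E)›
import Summits.HodgeConjecture.HodgeConjecture.Theorems.K2E3CentralUnipotentOrbitalMeasuresOfConvergence       -- ★ p856062 (K2E3-p23): ‹RAO-CONV_z› → ‹RAO_z›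
import Summits.HodgeConjecture.HodgeConjecture.Theorems.K2E3CentralUnipotentDualPieces                         -- ★ p855937 (K2E4-p21): ‹DUAL_z› outright
import Summits.HodgeConjecture.HodgeConjecture.Theorems.K2E3CentralUnipotentScalingPackageOfRankOne            -- ★ p856124 (K2E4-p18): ‹Ψ-package₂⁺› → ‹Ψ-package♮›
import Summits.HodgeConjecture.HodgeConjecture.Theorems.K2E3CentralUnipotentOrbitalConvergence                   -- ★ p856185 (K2E5-p11): ‹RAO-CONV_z› outright (`U3bCentralGerms.centralUnipotentOrbitalConvergence`)
import Summits.HodgeConjecture.HodgeConjecture.Theorems.K2E3CentralTransferVanishingLocalSplitOfCore            -- ★ p855774 (K2E4-p02∕p01): ‹B_loc^{split}› outright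
import Summits.HodgeConjecture.HodgeConjecture.Theorems.K2E3RankOneUnipotentScalingPackageOfIdentity           -- ★ p856384 (K2E4-p18): ‹Ψ-package₂¹› → ‹Ψ-package₂⁺›
import Summits.HodgeConjecture.HodgeConjecture.Theorems.K2E3RankOneUnipotentScalingPackageOne                  -- ★ p856553 (K2E5-p12): ‹Ψ-package₂¹› outright
import HarnessLib

/-!
# h413 ∕ Track B «K2-LIT» — THE ‹S› CLOSER, PART 1: `sig_K2E3SingularTransferSigned` (E4 FGC :380) FROM ‹J3› v2 (Rogawski 1990 Prop. 8.2.1 (a) with the Kottwitz signs)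

Cell `pub/hodgecm-mathlib`, crux H413 = `stmt-HodgeConjecture-24833`, route `HCCMUnconditional`.  THEOREMS ONLY (no `def`, no `instance`, no `notation`, no named-fact `def`,
no `sorry`, default heartbeats, NO `Lines` import); `--supports stmt-HodgeConjecture-24833 --as helper`; count-neutral.  Namespace
`Summit.HodgeConjecture.HodgeConjecture.Cruxes.H413.K2E3SingularTransferSigned` (E3-owned name, typed by the E4 consumer per K2E4-plan (g2)'s CLOSER PLAN 02:21:28Z + AMENDMENT
02:32:22Z, chair «=» 02:39:37Z, road owner K2E3-p15 (g3) (o3) 02:34:54Z, K2E4-p14 (g3) hand-over 02:42:20Z, K2E4-r02 (g2) type pre-dock 02:33:01Z).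

WHAT THIS FILE IS.  The E4 tier-1 socket ‹S› `K2E4SingularTransferKappaSign.FinGermConstants.sig_K2E3SingularTransferSigned` (Prop. 8.2.1 (a) with the (4.1.2) Kottwitz signs made
explicit at a non-split finite `v`, under the letters' frame) is tied by E4's host ONLY to a THEOREMS declaration.  Road J of record (U3b PART B ED. 7–9, every link ★): ‹S› ⟸ ‹S_loc›
(★ p855489 `singularTransferSigned_of_local`) ⟸ (J♮) + B_loc (★ p856015) ⟸ ‹J3› v2 ((β) ★ p856362) and the central-germ side (RAO-CONV_z ★ p856185 · DUAL_z ★ p855937 · (Ψ-package₂¹)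
★ p856553 → ★ p856384 → ★ p856124 · (E) ★ p856062∕p855998 · (HOM-ray*♮)∕(HOM-ray♮)∕(H♮) ★ p855910∕p855909∕p855908 · (S′♮) ★ p855868 · CERT♮ (ii♭′) ★ p855822 · (ii′) ★ p855627 ·
B_loc^{ns}∕B_loc ★ p855613 · B_loc^{split} ★ p855774) — PART B's sorry-free cert `germConstantStableSheets_of_twoLeaves` up to its `hS`, re-run here on THEOREMS names so that no socket
occurs.  ‹J3› v2 itself is REL over its residue-class leaves ((J3u) ★ p856780, (J3r) ★ p856843, (J3d-i) OPEN, (J3d-w) OPEN = accepted PRINT residual [Kottwitz1988 §1 Thm 1]); the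
companion file `K2E3SingularTransferSignedOfDyadicLeaves` composes this theorem with the trichotomy so that E4 can tie ‹S› REL over exactly the two dyadic leaves tonight.

* **`singularTransferSigned_of_J3 (hJ3 : ‹J3 v2›) : ‹S›`** — explicit binders: the frame's `L H′ Tinf νH νG νGi νqi νHi`, then `hJ3`; hypothesis = the text of U3b's
  `sig_K2E3CompatibleMeasureEPIdentityRankOne` (∃-form) = ★ p856362's hypothesis token for token; conclusion = FGC :380 ‹S› VERBATIM over the letters' frame (= ★ p855489's conclusion;
  home probe `K2/K2E4-p07/g4/Probe_S_dock.lean`: `type_of% (FinGermConstants.sig_K2E3SingularTransferSigned L H' Tinf νH νG νGi νqi νHi)` inhabited by this theorem applied to a ‹J3› v2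
  term built from the four PART C sockets — rc 0 against the BUILT FGC ED. 8 ∕ Leaves ED. 2).
[Rogawski1990 §8.2 Prop. 8.2.1 (a), (d) pp. 117–118; §8.1 Props. 8.1.3–8.1.4 pp. 116–117, (8.1.1)–(8.1.2) p. 117; §4.9 Prop. 4.9.1 (a) p. 55; §12.6 p. 174.] [Kottwitz1988 §1 Thm 1, §2 Thm 2.]
HONEST LABEL: HC_CM is proved only modulo the 7 printed citations (2 remaining named inputs: hLiu418 = stmt-HodgeConjecture-24832, h413 = stmt-HodgeConjecture-24833) until rung 0
closes; this file is an IMPLICATION — ‹S› stays REL (not ★) until every ‹J3› leaf is ★; REL ≠ ★; nothing printed is asserted here.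

## References
* [Rogawski1990] J. D. Rogawski, *Automorphic Representations of Unitary Groups in Three Variables*, Ann. of Math. Stud. 123 (1990): §8.1 Props. 8.1.3–8.1.4 pp. 116–117;
  §8.2 Prop. 8.2.1 (a), (d) pp. 117–118; §4.3 (4.3.1) p. 43; §4.9 Prop. 4.9.1 (a) p. 55; §12.6 p. 174.
* [Kottwitz1988] R. E. Kottwitz, *Tamagawa numbers*, Ann. of Math. 127 (1988), §1 Thm 1, Prop. 1; §2 Thm 2.
-/

set_option autoImplicit false
set_option linter.dupNamespace false

noncomputable section

open MeasureTheory Measure NumberField IsDedekindDomain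
open Literature.MeasureTheory.Group Literature.MeasureTheory.RestrictedProduct
open Literature.Topology.RestrictedProduct Literature.Topology.Algebra.RestrictedProduct
open Literature.NumberTheory.Rogawski1990 Literature.NumberTheory.Automorphic
open Literature.NumberTheory.GaloisRepresentations (HeckeCharacter ideleGroup)
open Literature.AlgebraicGeometry.ShimuraVarieties (unitaryGroup hermForm)
open scoped Matrix MatrixGroups RestrictedProduct NNReal

namespace Summit.HodgeConjecture.HodgeConjecture.Cruxes.H413.K2E3SingularTransferSigned

/-! ## The letters' frame (★ p844690's binders, byte-for-byte = FGC's `section Frame`) -/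

section Frame

variable (L : Type) [Field L] [NumberField L] [IsCMField L]

variable (H' : Matrix (Fin 3) (Fin 3) L) (Tinf : ArchTransferFactor L H')
    -- σ-algebras of the `G′` side (★ (O10-c5) block), of `H_v`, `G_∞`, `H_∞`, and the Haar data — EXACTLY ★ `SingularEllipticTransfer`'s binders
    [∀ g : (UnitaryGroup.cmDatum L 3 H').Adelic, MeasurableSpace ((UnitaryGroup.cmDatum L 3 H').Adelic ⧸ Subgroup.centralizer ({g} : Set (UnitaryGroup.cmDatum L 3 H').Adelic))]
    [∀ g : (UnitaryGroup.cmDatum L 3 H').Adelic, BorelSpace ((UnitaryGroup.cmDatum L 3 H').Adelic ⧸ Subgroup.centralizer ({g} : Set (UnitaryGroup.cmDatum L 3 H').Adelic))]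
    [∀ γ : UnitaryGroup.arch (↥(maximalRealSubfield L)) L (IsCMField.complexConj L) 3 H',
      MeasurableSpace (UnitaryGroup.arch (↥(maximalRealSubfield L)) L (IsCMField.complexConj L) 3 H' ⧸ Subgroup.centralizer ({γ} : Set (UnitaryGroup.arch (↥(maximalRealSubfield L)) L (IsCMField.complexConj L) 3 H')))]
    [∀ γ : UnitaryGroup.arch (↥(maximalRealSubfield L)) L (IsCMField.complexConj L) 3 H',
      BorelSpace (UnitaryGroup.arch (↥(maximalRealSubfield L)) L (IsCMField.complexConj L) 3 H' ⧸ Subgroup.centralizer ({γ} : Set (UnitaryGroup.arch (↥(maximalRealSubfield L)) L (IsCMField.complexConj L) 3 H')))]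
    [∀ (v : HeightOneSpectrum (𝓞 ↥(maximalRealSubfield L))) (γ : (UnitaryGroup.cmDatum L 3 H').Local v),
      MeasurableSpace ((UnitaryGroup.cmDatum L 3 H').Local v ⧸ Subgroup.centralizer ({γ} : Set ((UnitaryGroup.cmDatum L 3 H').Local v)))]
    [∀ (v : HeightOneSpectrum (𝓞 ↥(maximalRealSubfield L))) (γ : (UnitaryGroup.cmDatum L 3 H').Local v),
      BorelSpace ((UnitaryGroup.cmDatum L 3 H').Local v ⧸ Subgroup.centralizer ({γ} : Set ((UnitaryGroup.cmDatum L 3 H').Local v)))]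
    [∀ v : HeightOneSpectrum (𝓞 ↥(maximalRealSubfield L)), MeasurableSpace ((UnitaryGroup.cmDatum L 3 H').Local v)] [∀ v : HeightOneSpectrum (𝓞 ↥(maximalRealSubfield L)), BorelSpace ((UnitaryGroup.cmDatum L 3 H').Local v)]
    [MeasurableSpace (UnitaryGroup.cmDatum L 3 H').Adelic] [BorelSpace (UnitaryGroup.cmDatum L 3 H').Adelic]
    [MeasurableSpace (UnitaryGroup.arch (↥(maximalRealSubfield L)) L (IsCMField.complexConj L) 3 H')] [BorelSpace (UnitaryGroup.arch (↥(maximalRealSubfield L)) L (IsCMField.complexConj L) 3 H')]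
    [∀ γ : (UnitaryGroup.cmDatum L 3 H').Adelic, MeasurableSpace (↥(Subgroup.centralizer ({γ} : Set (UnitaryGroup.cmDatum L 3 H').Adelic)) ⧸
      ((UnitaryGroup.cmDatum L 3 H').quotientSubgroup ⊓ Subgroup.centralizer ({γ} : Set (UnitaryGroup.cmDatum L 3 H').Adelic)).subgroupOf (Subgroup.centralizer ({γ} : Set (UnitaryGroup.cmDatum L 3 H').Adelic)))]
    [∀ γ : (UnitaryGroup.cmDatum L 3 H').Adelic, BorelSpace (↥(Subgroup.centralizer ({γ} : Set (UnitaryGroup.cmDatum L 3 H').Adelic)) ⧸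
      ((UnitaryGroup.cmDatum L 3 H').quotientSubgroup ⊓ Subgroup.centralizer ({γ} : Set (UnitaryGroup.cmDatum L 3 H').Adelic)).subgroupOf (Subgroup.centralizer ({γ} : Set (UnitaryGroup.cmDatum L 3 H').Adelic)))]
    [hCcl : ∀ γ : (UnitaryGroup.cmDatum L 3 H').Adelic, IsClosed ((Subgroup.centralizer ({γ} : Set (UnitaryGroup.cmDatum L 3 H').Adelic) : Subgroup (UnitaryGroup.cmDatum L 3 H').Adelic) : Set (UnitaryGroup.cmDatum L 3 H').Adelic)]
    [∀ γ : (UnitaryGroup.cmDatum L 3 H').Adelic, (count : Measure ↥(((UnitaryGroup.cmDatum L 3 H').quotientSubgroup ⊓ Subgroup.centralizer ({γ} : Set (UnitaryGroup.cmDatum L 3 H').Adelic)).subgroupOf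
      (Subgroup.centralizer ({γ} : Set (UnitaryGroup.cmDatum L 3 H').Adelic)))).IsHaarMeasure]
    [∀ v : HeightOneSpectrum (𝓞 ↥(maximalRealSubfield L)), MeasurableSpace ((UnitaryGroup.cmDatum L 2 (Matrix.of fun i j : Fin 2 => if i.val + j.val + 1 = 2 then (1 : L) else 0)).Local v ×
        (UnitaryGroup.cmDatum L 1 (Matrix.of fun i j : Fin 1 => if i.val + j.val + 1 = 1 then (1 : L) else 0)).Local v)]
    [∀ v : HeightOneSpectrum (𝓞 ↥(maximalRealSubfield L)), BorelSpace ((UnitaryGroup.cmDatum L 2 (Matrix.of fun i j : Fin 2 => if i.val + j.val + 1 = 2 then (1 : L) else 0)).Local v ×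
        (UnitaryGroup.cmDatum L 1 (Matrix.of fun i j : Fin 1 => if i.val + j.val + 1 = 1 then (1 : L) else 0)).Local v)]
    [∀ (v : HeightOneSpectrum (𝓞 ↥(maximalRealSubfield L))) (a : ((UnitaryGroup.cmDatum L 2 (Matrix.of fun i j : Fin 2 => if i.val + j.val + 1 = 2 then (1 : L) else 0)).Local v ×
        (UnitaryGroup.cmDatum L 1 (Matrix.of fun i j : Fin 1 => if i.val + j.val + 1 = 1 then (1 : L) else 0)).Local v)),
      MeasurableSpace (((UnitaryGroup.cmDatum L 2 (Matrix.of fun i j : Fin 2 => if i.val + j.val + 1 = 2 then (1 : L) else 0)).Local v ×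
        (UnitaryGroup.cmDatum L 1 (Matrix.of fun i j : Fin 1 => if i.val + j.val + 1 = 1 then (1 : L) else 0)).Local v) ⧸ Subgroup.centralizer ({a} : Set ((UnitaryGroup.cmDatum L 2 (Matrix.of fun i j : Fin 2 => if i.val + j.val + 1 = 2 then (1 : L) else 0)).Local v ×
        (UnitaryGroup.cmDatum L 1 (Matrix.of fun i j : Fin 1 => if i.val + j.val + 1 = 1 then (1 : L) else 0)).Local v)))]
    [∀ (v : HeightOneSpectrum (𝓞 ↥(maximalRealSubfield L))) (a : ((UnitaryGroup.cmDatum L 2 (Matrix.of fun i j : Fin 2 => if i.val + j.val + 1 = 2 then (1 : L) else 0)).Local v ×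
        (UnitaryGroup.cmDatum L 1 (Matrix.of fun i j : Fin 1 => if i.val + j.val + 1 = 1 then (1 : L) else 0)).Local v)),
      BorelSpace (((UnitaryGroup.cmDatum L 2 (Matrix.of fun i j : Fin 2 => if i.val + j.val + 1 = 2 then (1 : L) else 0)).Local v ×
        (UnitaryGroup.cmDatum L 1 (Matrix.of fun i j : Fin 1 => if i.val + j.val + 1 = 1 then (1 : L) else 0)).Local v) ⧸ Subgroup.centralizer ({a} : Set ((UnitaryGroup.cmDatum L 2 (Matrix.of fun i j : Fin 2 => if i.val + j.val + 1 = 2 then (1 : L) else 0)).Local v ×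
        (UnitaryGroup.cmDatum L 1 (Matrix.of fun i j : Fin 1 => if i.val + j.val + 1 = 1 then (1 : L) else 0)).Local v)))]
    [MeasurableSpace (UnitaryGroup.arch (↥(maximalRealSubfield L)) L (IsCMField.complexConj L) 3 (Matrix.of fun i j : Fin 3 => if i.val + j.val + 1 = 3 then (1 : L) else 0))] [BorelSpace (UnitaryGroup.arch (↥(maximalRealSubfield L)) L (IsCMField.complexConj L) 3 (Matrix.of fun i j : Fin 3 => if i.val + j.val + 1 = 3 then (1 : L) else 0))]
    [∀ γ : UnitaryGroup.arch (↥(maximalRealSubfield L)) L (IsCMField.complexConj L) 3 (Matrix.of fun i j : Fin 3 => if i.val + j.val + 1 = 3 then (1 : L) else 0),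
      MeasurableSpace (UnitaryGroup.arch (↥(maximalRealSubfield L)) L (IsCMField.complexConj L) 3 (Matrix.of fun i j : Fin 3 => if i.val + j.val + 1 = 3 then (1 : L) else 0) ⧸ Subgroup.centralizer ({γ} : Set (UnitaryGroup.arch (↥(maximalRealSubfield L)) L (IsCMField.complexConj L) 3 (Matrix.of fun i j : Fin 3 => if i.val + j.val + 1 = 3 then (1 : L) else 0))))]
    [∀ γ : UnitaryGroup.arch (↥(maximalRealSubfield L)) L (IsCMField.complexConj L) 3 (Matrix.of fun i j : Fin 3 => if i.val + j.val + 1 = 3 then (1 : L) else 0),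
      BorelSpace (UnitaryGroup.arch (↥(maximalRealSubfield L)) L (IsCMField.complexConj L) 3 (Matrix.of fun i j : Fin 3 => if i.val + j.val + 1 = 3 then (1 : L) else 0) ⧸ Subgroup.centralizer ({γ} : Set (UnitaryGroup.arch (↥(maximalRealSubfield L)) L (IsCMField.complexConj L) 3 (Matrix.of fun i j : Fin 3 => if i.val + j.val + 1 = 3 then (1 : L) else 0))))]
    [MeasurableSpace (UnitaryGroup.arch (↥(maximalRealSubfield L)) L (IsCMField.complexConj L) 2 (Matrix.of fun i j : Fin 2 => if i.val + j.val + 1 = 2 then (1 : L) else 0) ×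
          UnitaryGroup.arch (↥(maximalRealSubfield L)) L (IsCMField.complexConj L) 1 (Matrix.of fun i j : Fin 1 => if i.val + j.val + 1 = 1 then (1 : L) else 0))]
    [BorelSpace (UnitaryGroup.arch (↥(maximalRealSubfield L)) L (IsCMField.complexConj L) 2 (Matrix.of fun i j : Fin 2 => if i.val + j.val + 1 = 2 then (1 : L) else 0) ×
          UnitaryGroup.arch (↥(maximalRealSubfield L)) L (IsCMField.complexConj L) 1 (Matrix.of fun i j : Fin 1 => if i.val + j.val + 1 = 1 then (1 : L) else 0))]
    [∀ a : (UnitaryGroup.arch (↥(maximalRealSubfield L)) L (IsCMField.complexConj L) 2 (Matrix.of fun i j : Fin 2 => if i.val + j.val + 1 = 2 then (1 : L) else 0) ×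
          UnitaryGroup.arch (↥(maximalRealSubfield L)) L (IsCMField.complexConj L) 1 (Matrix.of fun i j : Fin 1 => if i.val + j.val + 1 = 1 then (1 : L) else 0)),
      MeasurableSpace ((UnitaryGroup.arch (↥(maximalRealSubfield L)) L (IsCMField.complexConj L) 2 (Matrix.of fun i j : Fin 2 => if i.val + j.val + 1 = 2 then (1 : L) else 0) ×
          UnitaryGroup.arch (↥(maximalRealSubfield L)) L (IsCMField.complexConj L) 1 (Matrix.of fun i j : Fin 1 => if i.val + j.val + 1 = 1 then (1 : L) else 0)) ⧸ Subgroup.centralizer ({a} : Set (UnitaryGroup.arch (↥(maximalRealSubfield L)) L (IsCMField.complexConj L) 2 (Matrix.of fun i j : Fin 2 => if i.val + j.val + 1 = 2 then (1 : L) else 0) ×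
          UnitaryGroup.arch (↥(maximalRealSubfield L)) L (IsCMField.complexConj L) 1 (Matrix.of fun i j : Fin 1 => if i.val + j.val + 1 = 1 then (1 : L) else 0))))]
    [∀ a : (UnitaryGroup.arch (↥(maximalRealSubfield L)) L (IsCMField.complexConj L) 2 (Matrix.of fun i j : Fin 2 => if i.val + j.val + 1 = 2 then (1 : L) else 0) ×
          UnitaryGroup.arch (↥(maximalRealSubfield L)) L (IsCMField.complexConj L) 1 (Matrix.of fun i j : Fin 1 => if i.val + j.val + 1 = 1 then (1 : L) else 0)),
      BorelSpace ((UnitaryGroup.arch (↥(maximalRealSubfield L)) L (IsCMField.complexConj L) 2 (Matrix.of fun i j : Fin 2 => if i.val + j.val + 1 = 2 then (1 : L) else 0) ×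
          UnitaryGroup.arch (↥(maximalRealSubfield L)) L (IsCMField.complexConj L) 1 (Matrix.of fun i j : Fin 1 => if i.val + j.val + 1 = 1 then (1 : L) else 0)) ⧸ Subgroup.centralizer ({a} : Set (UnitaryGroup.arch (↥(maximalRealSubfield L)) L (IsCMField.complexConj L) 2 (Matrix.of fun i j : Fin 2 => if i.val + j.val + 1 = 2 then (1 : L) else 0) ×
          UnitaryGroup.arch (↥(maximalRealSubfield L)) L (IsCMField.complexConj L) 1 (Matrix.of fun i j : Fin 1 => if i.val + j.val + 1 = 1 then (1 : L) else 0))))]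
    (νH : ∀ v : HeightOneSpectrum (𝓞 ↥(maximalRealSubfield L)), Measure ((UnitaryGroup.cmDatum L 2 (Matrix.of fun i j : Fin 2 => if i.val + j.val + 1 = 2 then (1 : L) else 0)).Local v ×
        (UnitaryGroup.cmDatum L 1 (Matrix.of fun i j : Fin 1 => if i.val + j.val + 1 = 1 then (1 : L) else 0)).Local v))
    (νG : ∀ v : HeightOneSpectrum (𝓞 ↥(maximalRealSubfield L)), Measure ((UnitaryGroup.cmDatum L 3 H').Local v))
    [∀ v, IsFiniteMeasureOnCompacts (νH v)] [∀ v, (νH v).IsMulRightInvariant]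
    [∀ v, (νG v).IsHaarMeasure] [∀ v, (νG v).IsMulRightInvariant]  -- MAIN-b's strength (F2): `νG_v` Haar
    (νGi : Measure (UnitaryGroup.arch (↥(maximalRealSubfield L)) L (IsCMField.complexConj L) 3 H')) (νqi : Measure (UnitaryGroup.arch (↥(maximalRealSubfield L)) L (IsCMField.complexConj L) 3 (Matrix.of fun i j : Fin 3 => if i.val + j.val + 1 = 3 then (1 : L) else 0)))
    (νHi : Measure (UnitaryGroup.arch (↥(maximalRealSubfield L)) L (IsCMField.complexConj L) 2 (Matrix.of fun i j : Fin 2 => if i.val + j.val + 1 = 2 then (1 : L) else 0) ×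
          UnitaryGroup.arch (↥(maximalRealSubfield L)) L (IsCMField.complexConj L) 1 (Matrix.of fun i j : Fin 1 => if i.val + j.val + 1 = 1 then (1 : L) else 0)))
    [IsFiniteMeasureOnCompacts νGi] [νGi.IsMulRightInvariant] [IsFiniteMeasureOnCompacts νqi] [νqi.IsMulRightInvariant]
    [IsFiniteMeasureOnCompacts νHi] [νHi.IsMulRightInvariant]

/-! ## §1 ‹S› from ‹J3› v2 -/

set_option linter.unusedSectionVars false in  -- the frame's auto-included instance binders are part of ‹S›'s TYPE (bytes frozen); `omit` would change the type
open scoped Classical in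
/-- **‹S› FROM ‹J3› v2** — `singularTransferSigned_of_J3 hJ3 : ‹sig_K2E3SingularTransferSigned›` (conclusion bytes = FGC :380 VERBATIM under the letters' frame; hypothesis bytes =
U3b `sig_K2E3CompatibleMeasureEPIdentityRankOne` (∃-form) = ★ p856362's `hJ3`).  Proof: PART B's `germConstantStableSheets_of_twoLeaves` chain on THEOREMS names up to ‹S_loc›
(`hJ := localGermValue_of_rankOneMass hJ3`, `hS := singularTransferSignedLocal_of_localGermValue hJ hBloc`), then ★ `singularTransferSigned_of_local`.
[cite: Rogawski1990, §8.2 Prop. 8.2.1 (a) pp. 117–118; §8.1 Prop. 8.1.3 p. 116, (8.1.1)–(8.1.2) p. 117, Prop. 8.1.4 p. 117; §12.6 p. 174] [cite: Kottwitz1988, §1 Thm 1] -/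
theorem singularTransferSigned_of_J3
    (hJ3 :
      ∀ (L : Type) [Field L] [NumberField L] [IsCMField L] (H' : Matrix (Fin 3) (Fin 3) L) (μ : HeckeCharacter L)
        [∀ v : HeightOneSpectrum (𝓞 ↥(maximalRealSubfield L)),
          MeasurableSpace ((UnitaryGroup.cmDatum L 2 (Matrix.of fun i j : Fin 2 => if i.val + j.val + 1 = 2 then (1 : L) else 0)).Local v ×
            (UnitaryGroup.cmDatum L 1 (Matrix.of fun i j : Fin 1 => if i.val + j.val + 1 = 1 then (1 : L) else 0)).Local v)]
        [∀ v : HeightOneSpectrum (𝓞 ↥(maximalRealSubfield L)),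
          BorelSpace ((UnitaryGroup.cmDatum L 2 (Matrix.of fun i j : Fin 2 => if i.val + j.val + 1 = 2 then (1 : L) else 0)).Local v ×
            (UnitaryGroup.cmDatum L 1 (Matrix.of fun i j : Fin 1 => if i.val + j.val + 1 = 1 then (1 : L) else 0)).Local v)]
        [∀ v : HeightOneSpectrum (𝓞 ↥(maximalRealSubfield L)), MeasurableSpace ((UnitaryGroup.cmDatum L 3 H').Local v)]
        [∀ v : HeightOneSpectrum (𝓞 ↥(maximalRealSubfield L)), BorelSpace ((UnitaryGroup.cmDatum L 3 H').Local v)]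
        (νH : ∀ v : HeightOneSpectrum (𝓞 ↥(maximalRealSubfield L)),
          Measure ((UnitaryGroup.cmDatum L 2 (Matrix.of fun i j : Fin 2 => if i.val + j.val + 1 = 2 then (1 : L) else 0)).Local v ×
            (UnitaryGroup.cmDatum L 1 (Matrix.of fun i j : Fin 1 => if i.val + j.val + 1 = 1 then (1 : L) else 0)).Local v))
        (νG : ∀ v : HeightOneSpectrum (𝓞 ↥(maximalRealSubfield L)), Measure ((UnitaryGroup.cmDatum L 3 H').Local v))
        [∀ v, (νH v).IsHaarMeasure] [∀ v, (νH v).IsMulRightInvariant] [∀ v, (νG v).IsHaarMeasure] [∀ v, (νG v).IsMulRightInvariant],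
        μ.IsUnitary →
        (∀ x : ideleGroup ↥(maximalRealSubfield L), μ (AdeleRing.ideleBaseChange (↥(maximalRealSubfield L)) L x) = quadraticHeckeCharCM L x) →
        (H'.map (cmConjRingHom L)).transpose = H' →
        (∀ x : Fin 3 → L, Literature.AlgebraicGeometry.ShimuraVarieties.hermForm (cmConjRingHom L) H' x x = 0 → x = 0) →
        ∀ (v : HeightOneSpectrum (𝓞 ↥(maximalRealSubfield L))), Subsingleton (UnitaryGroup.PlacesOver L v) →
        ∀ [_iH : ∀ a : ((UnitaryGroup.cmDatum L 2 (Matrix.of fun i j : Fin 2 => if i.val + j.val + 1 = 2 then (1 : L) else 0)).Local v × (UnitaryGroup.cmDatum L 1 (Matrix.of fun i j : Fin 1 => if i.val + j.val + 1 = 1 then (1 : L) else 0)).Local v),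
            MeasurableSpace (((UnitaryGroup.cmDatum L 2 (Matrix.of fun i j : Fin 2 => if i.val + j.val + 1 = 2 then (1 : L) else 0)).Local v × (UnitaryGroup.cmDatum L 1 (Matrix.of fun i j : Fin 1 => if i.val + j.val + 1 = 1 then (1 : L) else 0)).Local v) ⧸
              Subgroup.centralizer ({a} : Set ((UnitaryGroup.cmDatum L 2 (Matrix.of fun i j : Fin 2 => if i.val + j.val + 1 = 2 then (1 : L) else 0)).Local v × (UnitaryGroup.cmDatum L 1 (Matrix.of fun i j : Fin 1 => if i.val + j.val + 1 = 1 then (1 : L) else 0)).Local v)))]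
          [_bH : ∀ a : ((UnitaryGroup.cmDatum L 2 (Matrix.of fun i j : Fin 2 => if i.val + j.val + 1 = 2 then (1 : L) else 0)).Local v × (UnitaryGroup.cmDatum L 1 (Matrix.of fun i j : Fin 1 => if i.val + j.val + 1 = 1 then (1 : L) else 0)).Local v),
            BorelSpace (((UnitaryGroup.cmDatum L 2 (Matrix.of fun i j : Fin 2 => if i.val + j.val + 1 = 2 then (1 : L) else 0)).Local v × (UnitaryGroup.cmDatum L 1 (Matrix.of fun i j : Fin 1 => if i.val + j.val + 1 = 1 then (1 : L) else 0)).Local v) ⧸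
              Subgroup.centralizer ({a} : Set ((UnitaryGroup.cmDatum L 2 (Matrix.of fun i j : Fin 2 => if i.val + j.val + 1 = 2 then (1 : L) else 0)).Local v × (UnitaryGroup.cmDatum L 1 (Matrix.of fun i j : Fin 1 => if i.val + j.val + 1 = 1 then (1 : L) else 0)).Local v)))]
          [_iG : ∀ γ : ((UnitaryGroup.cmDatum L 3 H').Local v), MeasurableSpace (((UnitaryGroup.cmDatum L 3 H').Local v) ⧸ Subgroup.centralizer ({γ} : Set ((UnitaryGroup.cmDatum L 3 H').Local v)))]
          [_bG : ∀ γ : ((UnitaryGroup.cmDatum L 3 H').Local v), BorelSpace (((UnitaryGroup.cmDatum L 3 H').Local v) ⧸ Subgroup.centralizer ({γ} : Set ((UnitaryGroup.cmDatum L 3 H').Local v)))]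
          (mH : OrbitalMeasureFamily ((UnitaryGroup.cmDatum L 2 (Matrix.of fun i j : Fin 2 => if i.val + j.val + 1 = 2 then (1 : L) else 0)).Local v × (UnitaryGroup.cmDatum L 1 (Matrix.of fun i j : Fin 1 => if i.val + j.val + 1 = 1 then (1 : L) else 0)).Local v))
          (mG : OrbitalMeasureFamily ((UnitaryGroup.cmDatum L 3 H').Local v)),
        mH.IsCanonical (IsLocalGRegular L v) (νH v) → mG.IsCanonical (fun γ => IsRegularElt (γ.val : GL (Fin 3) (UnitaryGroup.LocalRing L v))) (νG v) →
        ∀ (εH : ((UnitaryGroup.cmDatum L 2 (Matrix.of fun i j : Fin 2 => if i.val + j.val + 1 = 2 then (1 : L) else 0)).Local v × (UnitaryGroup.cmDatum L 1 (Matrix.of fun i j : Fin 1 => if i.val + j.val + 1 = 1 then (1 : L) else 0)).Local v)) (a : (UnitaryGroup.LocalRing L v)),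
          (εH.1.val.val : Matrix (Fin 2) (Fin 2) (UnitaryGroup.LocalRing L v)) = a • (1 : Matrix (Fin 2) (Fin 2) (UnitaryGroup.LocalRing L v)) →
          (εH.2.val.val : Matrix (Fin 1) (Fin 1) (UnitaryGroup.LocalRing L v)) 0 0 ≠ a →
          -- the central dock (★ `exists_centralDock_of_fst_eq_smul_one`)
          ∀ (ε : ((UnitaryGroup.cmDatum L 3 H').Local v)) (y : GL (Fin 3) (UnitaryGroup.LocalRing L v)) (θ : ((UnitaryGroup.cmDatum L 2 (Matrix.of fun i j : Fin 2 => if i.val + j.val + 1 = 2 then (1 : L) else 0)).Local v × (UnitaryGroup.cmDatum L 1 (Matrix.of fun i j : Fin 1 => if i.val + j.val + 1 = 1 then (1 : L) else 0)).Local v) ≃ₜ* ↥(Subgroup.centralizer ({ε} : Set ((UnitaryGroup.cmDatum L 3 H').Local v)))),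
          (θ εH).1 = ε →
          (∀ z : ((UnitaryGroup.cmDatum L 2 (Matrix.of fun i j : Fin 2 => if i.val + j.val + 1 = 2 then (1 : L) else 0)).Local v × (UnitaryGroup.cmDatum L 1 (Matrix.of fun i j : Fin 1 => if i.val + j.val + 1 = 1 then (1 : L) else 0)).Local v), (((θ z).1).val : GL (Fin 3) (UnitaryGroup.LocalRing L v)) = y * ((endoEmbLocal L v z).val : GL (Fin 3) (UnitaryGroup.LocalRing L v)) * y⁻¹) →
          -- the bad frame on the dock (★ `exists_badFrame_dock`)
          ∀ (W : GL (Fin 3) (UnitaryGroup.LocalRing L v)), W.val = !![(1 : UnitaryGroup.LocalRing L v), 0, 0; 0, 0, 1; 0, 1, 0] →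
          ∀ (G₁ G₁' : Matrix (Fin 2) (Fin 2) (UnitaryGroup.LocalRing L v)) (G₂ G₂' : Matrix (Fin 1) (Fin 1) (UnitaryGroup.LocalRing L v)) (P' : GL (Fin (2 + 1)) (UnitaryGroup.LocalRing L v)),
          twistGram (UnitaryGroup.conjLocal L (IsCMField.complexConj L) v) ((UnitaryGroup.adelicForm L 3 H').map (UnitaryGroup.adeleToLocal L v)) (y * W).val = UnitaryGroup.finSum 2 1 G₁ G₂ →
          twistGram (UnitaryGroup.conjLocal L (IsCMField.complexConj L) v) ((UnitaryGroup.adelicForm L 3 H').map (UnitaryGroup.adeleToLocal L v)) P'.val = UnitaryGroup.finSum 2 1 G₁' G₂' →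
          (¬ ∃ z : UnitaryGroup.LocalRing L v, IsUnit z ∧ G₁'.det = G₁.det * (UnitaryGroup.conjLocal L (IsCMField.complexConj L) v z * z)) →
          -- the orbit of the dock point `ε` is closed (`(ε − a)(ε − u) = 0` with `a − u` a unit: ★ `isClosed_conjClass_local_of_mul_sub_smul_eq_zero`)
          IsClosed {g : ((UnitaryGroup.cmDatum L 3 H').Local v) | ∃ x : ((UnitaryGroup.cmDatum L 3 H').Local v), x * ε * x⁻¹ = g} →
          -- an Euler–Poincaré datum `(ν₂, m₂, f₂, r)` on `U(Φ₂)_v` (★ J2♯ `rankOneEulerPoincareNonsplit_withCentralValue`'s inputs and conclusion fields, BOUND): Borel structures on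
          -- `U(Φ₂)_v` and its orbit spaces, a Haar measure `ν₂ = (pr₁)_* ν_H`, a family `m₂` canonical for the regular classes and `ν₂`, `f₂ ∈ C_c^∞(U(Φ₂)_v)` with orbital integrals
          -- `1 ∕ 0` on the regular elliptic ∕ split classes (w.r.t. `m₂`), and the scalar value `f₂(b·1) = −r`
          ∀ [_iU₂ : MeasurableSpace ((UnitaryGroup.cmDatum L 2 (Matrix.of fun i j : Fin 2 => if i.val + j.val + 1 = 2 then (1 : L) else 0)).Local v)] [_bU₂ : BorelSpace ((UnitaryGroup.cmDatum L 2 (Matrix.of fun i j : Fin 2 => if i.val + j.val + 1 = 2 then (1 : L) else 0)).Local v)]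
            [_iZ₂ : ∀ γ : ((UnitaryGroup.cmDatum L 2 (Matrix.of fun i j : Fin 2 => if i.val + j.val + 1 = 2 then (1 : L) else 0)).Local v), MeasurableSpace (((UnitaryGroup.cmDatum L 2 (Matrix.of fun i j : Fin 2 => if i.val + j.val + 1 = 2 then (1 : L) else 0)).Local v) ⧸ Subgroup.centralizer ({γ} : Set ((UnitaryGroup.cmDatum L 2 (Matrix.of fun i j : Fin 2 => if i.val + j.val + 1 = 2 then (1 : L) else 0)).Local v)))]
            [_bZ₂ : ∀ γ : ((UnitaryGroup.cmDatum L 2 (Matrix.of fun i j : Fin 2 => if i.val + j.val + 1 = 2 then (1 : L) else 0)).Local v), BorelSpace (((UnitaryGroup.cmDatum L 2 (Matrix.of fun i j : Fin 2 => if i.val + j.val + 1 = 2 then (1 : L) else 0)).Local v) ⧸ Subgroup.centralizer ({γ} : Set ((UnitaryGroup.cmDatum L 2 (Matrix.of fun i j : Fin 2 => if i.val + j.val + 1 = 2 then (1 : L) else 0)).Local v)))]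
            (ν₂ : Measure ((UnitaryGroup.cmDatum L 2 (Matrix.of fun i j : Fin 2 => if i.val + j.val + 1 = 2 then (1 : L) else 0)).Local v)) [ν₂.IsHaarMeasure] [ν₂.IsMulRightInvariant]
            (m₂ : OrbitalMeasureFamily ((UnitaryGroup.cmDatum L 2 (Matrix.of fun i j : Fin 2 => if i.val + j.val + 1 = 2 then (1 : L) else 0)).Local v)),
          Measure.map (Prod.fst : (((UnitaryGroup.cmDatum L 2 (Matrix.of fun i j : Fin 2 => if i.val + j.val + 1 = 2 then (1 : L) else 0)).Local v) × ((UnitaryGroup.cmDatum L 1 (Matrix.of fun i j : Fin 1 => if i.val + j.val + 1 = 1 then (1 : L) else 0)).Local v)) → ((UnitaryGroup.cmDatum L 2 (Matrix.of fun i j : Fin 2 => if i.val + j.val + 1 = 2 then (1 : L) else 0)).Local v)) (νH v) = ν₂ →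
          m₂.IsCanonical (fun γ => IsRegularElt (γ.val : GL (Fin 2) (UnitaryGroup.LocalRing L v))) ν₂ →
          -- ‹J3› (∃-form): an Euler–Poincaré datum `(f₂, r)` on `U(Φ₂)_v` for `(ν₂, m₂)` — ★ J2♯'s three conclusion fields — TOGETHER WITH the compatible-measure identity
          ∃ (f₂ : ((UnitaryGroup.cmDatum L 2 (Matrix.of fun i j : Fin 2 => if i.val + j.val + 1 = 2 then (1 : L) else 0)).Local v) → ℂ) (r : ℝ), IsLocSmooth f₂ ∧
          (∀ γ : ((UnitaryGroup.cmDatum L 2 (Matrix.of fun i j : Fin 2 => if i.val + j.val + 1 = 2 then (1 : L) else 0)).Local v), IsRegularElt (γ.val : GL (Fin 2) (UnitaryGroup.LocalRing L v)) → CompactSpace (Subgroup.centralizer ({γ} : Set ((UnitaryGroup.cmDatum L 2 (Matrix.of fun i j : Fin 2 => if i.val + j.val + 1 = 2 then (1 : L) else 0)).Local v))) →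
              classOrbitalIntegral m₂ f₂ (ConjClasses.mk γ) = 1) ∧
          (∀ γ : ((UnitaryGroup.cmDatum L 2 (Matrix.of fun i j : Fin 2 => if i.val + j.val + 1 = 2 then (1 : L) else 0)).Local v), IsRegularElt (γ.val : GL (Fin 2) (UnitaryGroup.LocalRing L v)) → ¬ CompactSpace (Subgroup.centralizer ({γ} : Set ((UnitaryGroup.cmDatum L 2 (Matrix.of fun i j : Fin 2 => if i.val + j.val + 1 = 2 then (1 : L) else 0)).Local v))) →
              classOrbitalIntegral m₂ f₂ (ConjClasses.mk γ) = 0) ∧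
          (∀ (z : ((UnitaryGroup.cmDatum L 2 (Matrix.of fun i j : Fin 2 => if i.val + j.val + 1 = 2 then (1 : L) else 0)).Local v)) (b : UnitaryGroup.LocalRing L v),
              ((z.val : GL (Fin 2) (UnitaryGroup.LocalRing L v)).val : Matrix (Fin 2) (Fin 2) (UnitaryGroup.LocalRing L v)) = b • (1 : Matrix (Fin 2) (Fin 2) (UnitaryGroup.LocalRing L v)) →
              f₂ z = -(r : ℂ)) ∧
            -- the identity: for every framed, matched second class `ε′` ((α)'s outputs) and every Haar comparison scalar `aθ` on `Z(ε)` ((β)'s (b3))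
            ∀ (ε' : ((UnitaryGroup.cmDatum L 3 H').Local v)),
              (ε'.val.val : Matrix (Fin 3) (Fin 3) (UnitaryGroup.LocalRing L v)) * P'.val =
                P'.val * UnitaryGroup.finSum 2 1 (a • (1 : Matrix (Fin 2) (Fin 2) (UnitaryGroup.LocalRing L v))) (εH.2.val.val : Matrix (Fin 1) (Fin 1) (UnitaryGroup.LocalRing L v)) →
              IsLocalNormPair L H' v εH ε' →
            ∀ (aθ : ℝ≥0),
              Measure.map (⇑θ) (νH v) = aθ • Literature.NumberTheory.Weil1982.UnitaryFinTopForm.finTamagawaPartner L 3 H' v ε →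
              r * (aθ : ℝ) * ((Literature.NumberTheory.Weil1982.UnitaryFinTopForm.finTamagawaPartner L 3 H' v ε') Set.univ).toReal = 1) :
        ∀ (hK : ∀ v : HeightOneSpectrum (𝓞 ↥(maximalRealSubfield L)), νG v (UnitaryGroup.cmLocalIntegralLevel L 3 H' v : Set ((UnitaryGroup.cmDatum L 3 H').Local v)) = 1)
          (hanis : ∀ x : Fin 3 → L, hermForm (cmConjRingHom L) H' x x = 0 → x = 0)
          (Sbad : Finset (HeightOneSpectrum (𝓞 ↥(maximalRealSubfield L))))
              (Δ : ∀ v : HeightOneSpectrum (𝓞 ↥(maximalRealSubfield L)), LocalTransferFactor L H' v)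
              (mH : ∀ v : HeightOneSpectrum (𝓞 ↥(maximalRealSubfield L)),
                OrbitalMeasureFamily ((UnitaryGroup.cmDatum L 2 (Matrix.of fun i j : Fin 2 => if i.val + j.val + 1 = 2 then (1 : L) else 0)).Local v ×
                  (UnitaryGroup.cmDatum L 1 (Matrix.of fun i j : Fin 1 => if i.val + j.val + 1 = 1 then (1 : L) else 0)).Local v))
              (mG : ∀ v : HeightOneSpectrum (𝓞 ↥(maximalRealSubfield L)), OrbitalMeasureFamily ((UnitaryGroup.cmDatum L 3 H').Local v))
          (m' : OrbitalMeasureFamily (UnitaryGroup.arch (↥(maximalRealSubfield L)) L (IsCMField.complexConj L) 3 H'))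
                (m : OrbitalMeasureFamily (UnitaryGroup.arch (↥(maximalRealSubfield L)) L (IsCMField.complexConj L) 3
                  (Matrix.of fun i j : Fin 3 => if i.val + j.val + 1 = 3 then (1 : L) else 0)))
                (mHi : OrbitalMeasureFamily (UnitaryGroup.arch (↥(maximalRealSubfield L)) L (IsCMField.complexConj L) 2
                    (Matrix.of fun i j : Fin 2 => if i.val + j.val + 1 = 2 then (1 : L) else 0) ×
                  UnitaryGroup.arch (↥(maximalRealSubfield L)) L (IsCMField.complexConj L) 1
                    (Matrix.of fun i j : Fin 1 => if i.val + j.val + 1 = 1 then (1 : L) else 0)))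
                (t' : ∀ γ' : UnitaryGroup.arch (↥(maximalRealSubfield L)) L (IsCMField.complexConj L) 3 H',
                  Measure (Subgroup.centralizer ({γ'} : Set (UnitaryGroup.arch (↥(maximalRealSubfield L)) L (IsCMField.complexConj L) 3 H'))))
                (t : ∀ γ : UnitaryGroup.arch (↥(maximalRealSubfield L)) L (IsCMField.complexConj L) 3
                    (Matrix.of fun i j : Fin 3 => if i.val + j.val + 1 = 3 then (1 : L) else 0),
                  Measure (Subgroup.centralizer ({γ} : Set (UnitaryGroup.arch (↥(maximalRealSubfield L)) L (IsCMField.complexConj L) 3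
                    (Matrix.of fun i j : Fin 3 => if i.val + j.val + 1 = 3 then (1 : L) else 0)))))
                (tH : ∀ γH : UnitaryGroup.arch (↥(maximalRealSubfield L)) L (IsCMField.complexConj L) 2
                      (Matrix.of fun i j : Fin 2 => if i.val + j.val + 1 = 2 then (1 : L) else 0) ×
                    UnitaryGroup.arch (↥(maximalRealSubfield L)) L (IsCMField.complexConj L) 1
                      (Matrix.of fun i j : Fin 1 => if i.val + j.val + 1 = 1 then (1 : L) else 0),
                  Measure (Subgroup.centralizer ({γH} : Set (UnitaryGroup.arch (↥(maximalRealSubfield L)) L (IsCMField.complexConj L) 2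
                      (Matrix.of fun i j : Fin 2 => if i.val + j.val + 1 = 2 then (1 : L) else 0) ×
                    UnitaryGroup.arch (↥(maximalRealSubfield L)) L (IsCMField.complexConj L) 1
                      (Matrix.of fun i j : Fin 1 => if i.val + j.val + 1 = 1 then (1 : L) else 0)))))
            (hherm : (H'.map (cmConjRingHom L)).transpose = H')
            (hCTM : CanonicalTransferMatrix L H' Tinf.Δ νH νG Sbad Δ mH mG)
            (hACS : ArchCanonicalSingularMatrix L H' Tinf νGi νqi νHi hanis m' m mHi t' t tH),
    ∀ (μ : Literature.NumberTheory.GaloisRepresentations.HeckeCharacter L) (hμu : μ.IsUnitary)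
      (hμω : ∀ x : Literature.NumberTheory.GaloisRepresentations.ideleGroup ↥(maximalRealSubfield L),
        μ (AdeleRing.ideleBaseChange (↥(maximalRealSubfield L)) L x) = quadraticHeckeCharCM L x)
      (hΔ : Δ = finExplicitCollection L H' μ (finExplicitDelta_conj_left_all L H' μ) (finExplicitDelta_conj_right_all L H' μ))
      (hTinf : Tinf = archCanonicalTransferFactor L H' μ),
        ∀ (mGs₀ : ∀ v : HeightOneSpectrum (𝓞 ↥(maximalRealSubfield L)), OrbitalMeasureFamily ((UnitaryGroup.cmDatum L 3 H').Local v)),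
          (∀ v, (mGs₀ v).IsQuotientOf (fun x : (UnitaryGroup.cmDatum L 3 H').Local v => ∃ γ₀ : (UnitaryGroup.cmDatum L 3 H').Rational, ¬ IsRegularElt (γ₀.val : GL (Fin 3) L) ∧
                Corresponds (UnitaryGroup.conjLocal L (IsCMField.complexConj L) v)
                  ((UnitaryGroup.adelicForm L 3 H').map (UnitaryGroup.adeleToLocal L v))
                  ((UnitaryGroup.adelicForm L 3 H').map (UnitaryGroup.adeleToLocal L v))
                  ((UnitaryGroup.cmDatum L 3 H').toLocal v ((UnitaryGroup.cmDatum L 3 H').toAdelic γ₀)) x) (νG v) (Literature.NumberTheory.Weil1982.UnitaryFinTopForm.finTamagawaPartner L 3 H' v)) →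
              ∀ (γ₀ : (UnitaryGroup.cmDatum L 3 H').Rational) (e₁ e₂ : L), e₁ ≠ e₂ →
                ((((γ₀ : unitaryGroup (cmConjRingHom L) H').val : GL (Fin 3) L) : Matrix (Fin 3) (Fin 3) L) - e₁ • (1 : Matrix (Fin 3) (Fin 3) L)) * ((((γ₀ : unitaryGroup (cmConjRingHom L) H').val : GL (Fin 3) L) : Matrix (Fin 3) (Fin 3) L) - e₂ • (1 : Matrix (Fin 3) (Fin 3) L)) = 0 →
                (¬ ∃ ζ : L, (((γ₀ : unitaryGroup (cmConjRingHom L) H').val : GL (Fin 3) L) : Matrix (Fin 3) (Fin 3) L) = ζ • (1 : Matrix (Fin 3) (Fin 3) L)) →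
                (((γ₀ : unitaryGroup (cmConjRingHom L) H').val : GL (Fin 3) L) : Matrix (Fin 3) (Fin 3) L).charpoly =
                  (Polynomial.X - Polynomial.C e₁) ^ 2 * (Polynomial.X - Polynomial.C e₂) →
                ∀ (γH : (UnitaryGroup.cmDatum L 2 (Matrix.of fun i j : Fin 2 => if i.val + j.val + 1 = 2 then (1 : L) else 0)).Rational ×
                    (UnitaryGroup.cmDatum L 1 (Matrix.of fun i j : Fin 1 => if i.val + j.val + 1 = 1 then (1 : L) else 0)).Rational),
                  (((γH.1 : unitaryGroup (cmConjRingHom L) (Matrix.of fun i j : Fin 2 => if i.val + j.val + 1 = 2 then (1 : L) else 0)).val : GL (Fin 2) L) : Matrix (Fin 2) (Fin 2) L) =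
                    e₁ • (1 : Matrix (Fin 2) (Fin 2) L) →
                  (((γH.2 : unitaryGroup (cmConjRingHom L) (Matrix.of fun i j : Fin 1 => if i.val + j.val + 1 = 1 then (1 : L) else 0)).val : GL (Fin 1) L) : Matrix (Fin 1) (Fin 1) L) 0 0 = e₂ →
                  ∀ (v : HeightOneSpectrum (𝓞 ↥(maximalRealSubfield L))), Subsingleton (UnitaryGroup.PlacesOver L v) →
                    ∃ c : ℝ, c ≠ 0 ∧
                      (c < 0 ↔ (∀ x : Fin 3 → UnitaryGroup.LocalRing L v,
                      Matrix.mulVec (((((γ₀ : unitaryGroup (cmConjRingHom L) H').val : GL (Fin 3) L) : Matrix (Fin 3) (Fin 3) L)).map (algebraMap L (UnitaryGroup.LocalRing L v)) -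
                          algebraMap L (UnitaryGroup.LocalRing L v) e₁ • (1 : Matrix (Fin 3) (Fin 3) (UnitaryGroup.LocalRing L v))) x = 0 →
                      (∑ i, ∑ j, UnitaryGroup.conjLocal L (IsCMField.complexConj L) v (x i) * algebraMap L (UnitaryGroup.LocalRing L v) (H' i j) * x j) = 0 →
                      x = 0)) ∧ ∀
                          (fH : (UnitaryGroup.cmDatum L 2 (Matrix.of fun i j : Fin 2 => if i.val + j.val + 1 = 2 then (1 : L) else 0)).Local v × (UnitaryGroup.cmDatum L 1 (Matrix.of fun i j : Fin 1 => if i.val + j.val + 1 = 1 then (1 : L) else 0)).Local v → ℂ) (f : (UnitaryGroup.cmDatum L 3 H').Local v → ℂ),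
                        IsLocSmooth f → IsLocSmooth fH → IsLocalDeltaTransfer L H' v (Δ v) (mH v) (mG v) fH f →
                        (Δ v).Δ ((UnitaryGroup.cmDatum L 2 (Matrix.of fun i j : Fin 2 => if i.val + j.val + 1 = 2 then (1 : L) else 0)).toLocal v ((UnitaryGroup.cmDatum L 2 (Matrix.of fun i j : Fin 2 => if i.val + j.val + 1 = 2 then (1 : L) else 0)).toAdelic γH.1),
                            (UnitaryGroup.cmDatum L 1 (Matrix.of fun i j : Fin 1 => if i.val + j.val + 1 = 1 then (1 : L) else 0)).toLocal v ((UnitaryGroup.cmDatum L 1 (Matrix.of fun i j : Fin 1 => if i.val + j.val + 1 = 1 then (1 : L) else 0)).toAdelic γH.2)) ((UnitaryGroup.cmDatum L 3 H').toLocal v ((UnitaryGroup.cmDatum L 3 H').toAdelic γ₀)) *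
                          localStableOrbitalIntegral L 3 H' v (mGs₀ v) f ((UnitaryGroup.cmDatum L 3 H').toLocal v ((UnitaryGroup.cmDatum L 3 H').toAdelic γ₀)) =
                          (c : ℂ) * fH ((UnitaryGroup.cmDatum L 2 (Matrix.of fun i j : Fin 2 => if i.val + j.val + 1 = 2 then (1 : L) else 0)).toLocal v ((UnitaryGroup.cmDatum L 2 (Matrix.of fun i j : Fin 2 => if i.val + j.val + 1 = 2 then (1 : L) else 0)).toAdelic γH.1),
                            (UnitaryGroup.cmDatum L 1 (Matrix.of fun i j : Fin 1 => if i.val + j.val + 1 = 1 then (1 : L) else 0)).toLocal v ((UnitaryGroup.cmDatum L 1 (Matrix.of fun i j : Fin 1 => if i.val + j.val + 1 = 1 then (1 : L) else 0)).toAdelic γH.2)) := by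
  -- the central-germ side of U3b (PART B `germConstantStableSheets_of_twoLeaves`, links ★ BY NAME)
  have hconv := @Summit.HodgeConjecture.HodgeConjecture.Cruxes.H413.K2E3EllipticInputs.U3bCentralGerms.centralUnipotentOrbitalConvergence
  have hdual := @Summit.HodgeConjecture.HodgeConjecture.Cruxes.H413.K2E3CentralUnipotentDualPieces.centralUnipotentDualPieces
  have hΨ2 := Summit.HodgeConjecture.HodgeConjecture.Cruxes.H413.K2E3RankOneUnipotentScalingPackageOfIdentity.rankOneUnipotentScalingPackage_of_identity
    Summit.HodgeConjecture.HodgeConjecture.Cruxes.H413.K2E3RankOneUnipotentScalingPackageOne.rankOneUnipotentScalingPackageOne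
  have hΨ := Summit.HodgeConjecture.HodgeConjecture.Cruxes.H413.K2E3CentralUnipotentScalingPackageOfRankOne.centralUnipotentScalingPackage_of_rankOne hΨ2
  have hE := Summit.HodgeConjecture.HodgeConjecture.Cruxes.H413.K2E3CentralGermExpansionExistenceOfRao.centralGermExpansionExistence_of_rao_of_dual
    (Summit.HodgeConjecture.HodgeConjecture.Cruxes.H413.K2E3CentralUnipotentOrbitalMeasuresOfConvergence.centralUnipotentOrbitalMeasures_of_convergence hconv) hdual
  have hRef := Summit.HodgeConjecture.HodgeConjecture.Cruxes.H413.K2E3CentralGermHomogeneityRayNstRefOfUnipotentScaling.centralGermHomogeneityRayNstRef_of_unipotentScaling hE hdual hΨ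
  have hHRN := Summit.HodgeConjecture.HodgeConjecture.Cruxes.H413.K2E3CentralGermHomogeneityRayNstOfReference.centralGermHomogeneityRayNst_of_reference hdual hRef
  have hHN := Summit.HodgeConjecture.HodgeConjecture.Cruxes.H413.K2E3CentralGermIndependenceNstOfHomogeneityRay.centralGermIndependenceNst_of_homogeneityRayNst hHRN
  have hIIflat := Summit.HodgeConjecture.HodgeConjecture.Cruxes.H413.K2E3CentralGermExpansionHOfEPWitness.centralGermExpansionH_of_EPWitness hE hHN
    Summit.HodgeConjecture.HodgeConjecture.Cruxes.H413.K2E3CentralGermEPWitnessStable.centralGermEPWitnessStable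
  have hBloc := Summit.HodgeConjecture.HodgeConjecture.Cruxes.H413.K2E3CentralTransferVanishingLocalOfEllipticGerms.centralTransferVanishingLocal_of_nonsplit_of_split
    (Summit.HodgeConjecture.HodgeConjecture.Cruxes.H413.K2E3CentralTransferVanishingLocalOfEllipticGerms.centralTransferVanishingLocalNonsplit_of_ellipticHSide
      (Summit.HodgeConjecture.HodgeConjecture.Cruxes.H413.K2E3SingularLimitFormulaHSideEllipticOfCore.singularLimitFormulaHSideElliptic_of_core hIIflat))
    Summit.HodgeConjecture.HodgeConjecture.Cruxes.H413.K2E3CentralTransferVanishingSplit.centralTransferVanishingLocal_split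
  -- road J: ‹J3› v2 → (J♮) → ‹S_loc›
  have hJ := Summit.HodgeConjecture.HodgeConjecture.Cruxes.H413.K2E3SingularTransferLocalGermValueOfRoadJ.localGermValue_of_rankOneMass hJ3
  have hS := Summit.HodgeConjecture.HodgeConjecture.Cruxes.H413.K2E3SingularTransferSignedLocalOfLocalGermValue.singularTransferSignedLocal_of_localGermValue hJ hBloc
  -- ‹S_loc› → ‹S› under the frame
  exact Summit.HodgeConjecture.HodgeConjecture.Cruxes.H413.K2E3SingularTransferSignedOfLocal.singularTransferSigned_of_local (hS := hS) L H' Tinf νH νG νGi νqi νHi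

end Frame

end Summit.HodgeConjecture.HodgeConjecture.Cruxes.H413.K2E3SingularTransferSigned

end
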